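import Summits.NavierStokesRegularity.NavierStokesRegularity.Theorems.SoloRefuteAbuGhuwaleh2026b

/-!
# C61b `AbuGhuwaleh2026b` — ADDENDUM: the kill of Theorem 4.2 (24)–(25) at EVERY cutoff `c_* ∈ (0,1]`
(the print's «c_* > 0 sufficiently small and fixed once and for all», p.2 l.20–25)

Referee ref-1 g3's READ-BACK (RETYPE.md §2 R#1, 2026-08-27T04:30Z) on the kill of record
`not_Step2_Thm42_2425` (p495906, instantiated at `c_* = 1`): the typed `∀ c_* ∈ (0,1]` is stronger
than the print, which fixes `L_j = c_* R^{3/4}` with `c_*` small once and for all; the charitable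
re-typing R#1 is `∃ c₀ > 0, ∀ c_* ∈ (0,c₀], ∃ C, ∀ R ≥ 1, …` (same body). This file lands its kernel
face: for EVERY fixed `c ∈ (0,1]` the `R`-uniform bounds (25a) and (24)–(25) fail
(`not_Step2L_Thm42_25a_at`, `not_Step2_Thm42_2425_at`), hence the R#1 forms fail
(`not_Step2L_Thm42_25a_small`, `not_Step2_Thm42_2425_small`). Witness = the file of record's family
with the cube scaled by `c`: `R = t⁴`, `m = ⌊c t³/√3⌋` (so `√3 m ≤ c t³ = c R^{3/4}`), `A = cube m`,
`a ≡ 1`, `K = k₀ + cube(3m)`, `k₀ = (t⁴ + 3m, 0, 0)`, `v = 𝟙_K`; `absSum ≥ N³`, right side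
`≤ 27 C t⁸ N²` with `N = (2m+1)³ > c³ t⁹/(3√3)`, so `t < 81√3·C/c³` — contradiction for
`t = ⌈81√3·C/c³⌉ + 7`. The ratio grows like `c³ R^{1/4}`: a small `c_*` delays, never prevents.
[cite: AbuGhuwaleh2026b, Thm 4.2 (24)–(25) p.10; proof p.11 l.1–9; p.2 l.20–25; Prop 4.1 p.9]

WHAT THIS IS NOT: not a claim about NS regularity or blow-up; not a claim about any author beyond
the typed locator.
-/

set_option linter.dupNamespace false

open Finset Literature.Analysis.FunctionSpaces

namespace Summit.NavierStokesRegularity.NavierStokesRegularity.Theorems.AbuGhuwaleh2026b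

open Literature.Claims.NS.AbuGhuwaleh2026b

/-- Parameters at cutoff `c ∈ (0,1]`: `t = ⌈81√3·C/c³⌉ + 7`, `m = ⌊c t³/√3⌋`, giving `1 ≤ t⁴`,
`81√3·C/c³ < t`, `√3 m ≤ c t³ < √3 (m+1)`, `7m ≤ t⁴`. -/
theorem params_at {c : ℝ} (hc : 0 < c) (hc1 : c ≤ 1) (C : ℝ) : ∃ t m : ℕ,
    (1 : ℝ) ≤ (t : ℝ) ^ 4 ∧ 81 * Real.sqrt 3 * C / c ^ 3 < t ∧
    Real.sqrt 3 * (m : ℝ) ≤ c * (t : ℝ) ^ 3 ∧ c * (t : ℝ) ^ 3 / Real.sqrt 3 < (m : ℝ) + 1 ∧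
    7 * (m : ℝ) ≤ (t : ℝ) ^ 4 := by
  have hs3 : 0 < Real.sqrt 3 := Real.sqrt_pos.mpr (by norm_num)
  have hs3' : (1 : ℝ) ≤ Real.sqrt 3 := by
    rw [show (1 : ℝ) = Real.sqrt 1 by simp]
    exact Real.sqrt_le_sqrt (by norm_num)
  set t : ℕ := ⌈81 * Real.sqrt 3 * C / c ^ 3⌉₊ + 7 with ht_def
  have ht7 : (7 : ℝ) ≤ t := by
    have : 7 ≤ t := by omega
    exact_mod_cast this
  set L : ℝ := c * (t : ℝ) ^ 3 / Real.sqrt 3 with hL_def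
  have hL0 : 0 ≤ L := by positivity
  set m : ℕ := ⌊L⌋₊ with hm_def
  have hmL : (m : ℝ) ≤ L := Nat.floor_le hL0
  refine ⟨t, m, one_le_pow₀ (by linarith), ?_, ?_, Nat.lt_floor_add_one L, ?_⟩
  · have h1 : 81 * Real.sqrt 3 * C / c ^ 3 ≤ ⌈81 * Real.sqrt 3 * C / c ^ 3⌉₊ := Nat.le_ceil _
    have h2 : (⌈81 * Real.sqrt 3 * C / c ^ 3⌉₊ : ℝ) + 7 = t := by rw [ht_def]; push_cast; ring
    linarith
  · have := (le_div_iff₀ hs3).mp hmL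
    linarith
  · have ht3 : (0 : ℝ) ≤ (t : ℝ) ^ 3 := by positivity
    have hm3 : (m : ℝ) ≤ (t : ℝ) ^ 3 := by
      calc (m : ℝ) ≤ L := hmL
        _ ≤ c * (t : ℝ) ^ 3 := div_le_self (by positivity) hs3'
        _ ≤ 1 * (t : ℝ) ^ 3 := mul_le_mul_of_nonneg_right hc1 ht3
        _ = (t : ℝ) ^ 3 := one_mul _
    calc 7 * (m : ℝ) ≤ 7 * (t : ℝ) ^ 3 := by linarith
      _ ≤ t * (t : ℝ) ^ 3 := by gcongr
      _ = (t : ℝ) ^ 4 := by ring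

/-- The low cube lies in the ball `|p| ≤ c (t⁴)^{3/4} = c t³` once `√3 m ≤ c t³`. -/
theorem low_bounds_at {c : ℝ} (hc : 0 < c) {t m : ℕ} (hm : Real.sqrt 3 * (m : ℝ) ≤ c * (t : ℝ) ^ 3)
    {p : Z3} (hp : p ∈ cube m) : lnorm p ≤ c * ((t : ℝ) ^ 4) ^ (3 / 4 : ℝ) := by
  rw [rpow_four_three_quarters (Nat.cast_nonneg _)]
  refine lnorm_le_of_mem_cube hp (by positivity) ?_
  have h0 : 0 ≤ Real.sqrt 3 * (m : ℝ) := by positivity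
  have h2 : (Real.sqrt 3 * (m : ℝ)) ^ 2 ≤ (c * (t : ℝ) ^ 3) ^ 2 := pow_le_pow_left₀ h0 hm 2
  have h3 : (Real.sqrt 3 * (m : ℝ)) ^ 2 = 3 * (m : ℝ) ^ 2 := by
    rw [mul_pow, Real.sq_sqrt (by norm_num : (0 : ℝ) ≤ 3)]
  linarith

/-- The final arithmetic at cutoff `c`: `(2m+1)³ ≤ 27·C·t⁸` with `2m+1 > c t³/√3` forces
`t < 81√3·C/c³`. -/
theorem arith_core_at {c C : ℝ} (hc : 0 < c) {t m : ℕ} (htC : 81 * Real.sqrt 3 * C / c ^ 3 < t)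
    (hmL' : c * (t : ℝ) ^ 3 / Real.sqrt 3 < (m : ℝ) + 1)
    (key : (2 * (m : ℝ) + 1) ^ 3 ≤ 27 * C * (t : ℝ) ^ 8) : False := by
  have hs3 : 0 < Real.sqrt 3 := Real.sqrt_pos.mpr (by norm_num)
  have hc3 : 0 < c ^ 3 := pow_pos hc 3
  set L : ℝ := c * (t : ℝ) ^ 3 / Real.sqrt 3 with hL_def
  have hL0 : 0 ≤ L := by positivity
  have h2m : L < 2 * (m : ℝ) + 1 := by
    have : (0 : ℝ) ≤ m := Nat.cast_nonneg _
    linarith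
  have hcube : L ^ 3 < (2 * (m : ℝ) + 1) ^ 3 := pow_lt_pow_left₀ h2m hL0 (by norm_num)
  have hL3 : L ^ 3 = c ^ 3 * (t : ℝ) ^ 9 / (3 * Real.sqrt 3) := by
    rw [hL_def, div_pow]
    have : Real.sqrt 3 ^ 3 = 3 * Real.sqrt 3 := by
      rw [pow_succ, Real.sq_sqrt (by norm_num : (0 : ℝ) ≤ 3)]
    rw [this]; ring
  have hfin : c ^ 3 * (t : ℝ) ^ 9 < 81 * Real.sqrt 3 * C * (t : ℝ) ^ 8 := by
    have h1 : c ^ 3 * (t : ℝ) ^ 9 / (3 * Real.sqrt 3) < 27 * C * (t : ℝ) ^ 8 := by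
      rw [← hL3]; linarith
    rw [div_lt_iff₀ (by positivity)] at h1
    linarith
  have ht8 : (0 : ℝ) ≤ (t : ℝ) ^ 8 := by positivity
  have hlt : c ^ 3 * (t : ℝ) < 81 * Real.sqrt 3 * C := by
    have h1 : (c ^ 3 * (t : ℝ)) * (t : ℝ) ^ 8 < (81 * Real.sqrt 3 * C) * (t : ℝ) ^ 8 := by
      calc (c ^ 3 * (t : ℝ)) * (t : ℝ) ^ 8 = c ^ 3 * (t : ℝ) ^ 9 := by ring
        _ < _ := hfin
    exact lt_of_mul_lt_mul_right h1 ht8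
  have hge : 81 * Real.sqrt 3 * C < c ^ 3 * (t : ℝ) := by
    have := (div_lt_iff₀ hc3).mp htC
    linarith
  linarith

/-- **Literal face at every cutoff** — Theorem 4.2 (25) first half p.10 with `L = c R^{3/4}`, any
fixed `c ∈ (0,1]`: `(Σ_p |â(p)|)² ≤ C R² Σ_p |â(p)|²` fails `R`-uniformly (cube indicator,
`(2m+1)³ ≍ c³ R^{9/4}`). [cite: AbuGhuwaleh2026b, Thm 4.2 (25) p.10; p.2 l.20–25; Prop 4.1 p.9] -/
theorem not_Step2L_Thm42_25a_at {c : ℝ} (hc : 0 < c) (hc1 : c ≤ 1) :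
    ¬ ∃ C : ℝ, ∀ R : ℝ, 1 ≤ R → ∀ (A : Finset Z3) (a : Z3 → ℝ),
      (∀ p ∈ A, lnorm p ≤ c * R ^ (3 / 4 : ℝ)) →
        (∑ p ∈ A, |a p|) ^ 2 ≤ C * R ^ 2 * ∑ p ∈ A, a p ^ 2 := by
  rintro ⟨C, hC⟩
  obtain ⟨t, m, ht1, htC, hm1, hmL', -⟩ := params_at hc hc1 C
  have key := hC ((t : ℝ) ^ 4) ht1 (cube m) (fun _ => 1) (fun p hp => low_bounds_at hc hm1 hp)
  rw [sum_abs_one_cube, sum_sq_one_cube] at key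
  have hN : (0 : ℝ) < (2 * (m : ℝ) + 1) ^ 3 := by positivity
  have key2 : (2 * (m : ℝ) + 1) ^ 3 ≤ C * (t : ℝ) ^ 8 := by
    have h' : (2 * (m : ℝ) + 1) ^ 3 * (2 * (m : ℝ) + 1) ^ 3
        ≤ (C * (t : ℝ) ^ 8) * (2 * (m : ℝ) + 1) ^ 3 := by
      calc _ = ((2 * (m : ℝ) + 1) ^ 3) ^ 2 := by ring
        _ ≤ C * ((t : ℝ) ^ 4) ^ 2 * (2 * (m : ℝ) + 1) ^ 3 := key
        _ = _ := by ring
    exact le_of_mul_le_mul_right h' hN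
  have hC0 : 0 ≤ C * (t : ℝ) ^ 8 := hN.le.trans key2
  exact arith_core_at hc htC hmL' (by nlinarith)

/-- **Chain face at every cutoff** — Theorem 4.2 p.10 last display → (24) → (25) with
`L = c R^{3/4}`, any fixed `c ∈ (0,1]`: `absSum ≤ C R² ‖a‖² ‖v‖²` fails `R`-uniformly
(cube × translated cube, ratio `≍ c³ R^{1/4}`).
[cite: AbuGhuwaleh2026b, Thm 4.2 (24)–(25) p.10; proof p.11 l.1–9; p.2 l.20–25] -/
theorem not_Step2_Thm42_2425_at {c : ℝ} (hc : 0 < c) (hc1 : c ≤ 1) :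
    ¬ ∃ C : ℝ, ∀ R : ℝ, 1 ≤ R → ∀ (A K : Finset Z3) (a v : Z3 → ℝ),
      (∀ p ∈ A, lnorm p ≤ c * R ^ (3 / 4 : ℝ)) →
      (∀ k ∈ K, R ≤ lnorm k ∧ lnorm k ≤ 2 * R) → (∀ k, k ∉ K → v k = 0) →
        absSum A K a v ≤ C * R ^ 2 * (∑ p ∈ A, a p ^ 2) * (∑ k ∈ K, v k ^ 2) := by
  rintro ⟨C, hC⟩
  obtain ⟨t, m, ht1, htC, hm1, hmL', hmX⟩ := params_at hc hc1 C
  have key := hC ((t : ℝ) ^ 4) ht1 (cube m) (tcube (kzero t m) (3 * m)) (fun _ => 1)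
    (ind (tcube (kzero t m) (3 * m))) (fun p hp => low_bounds_at hc hm1 hp)
    (fun k hk => shell_bounds hmX hk) (fun k hk => ind_of_not_mem hk)
  rw [sum_sq_one_cube, sum_sq_ind_tcube] at key
  push_cast at key
  have low := absSum_lower (kzero t m) m
  set N : ℝ := (2 * (m : ℝ) + 1) ^ 3 with hN_def
  have hN : 0 < N := by positivity
  have h27 : (2 * ((3 : ℝ) * m) + 1) ^ 3 ≤ 27 * N := by
    have : (2 * ((3 : ℝ) * m) + 1) ≤ 3 * (2 * (m : ℝ) + 1) := by linarith
    calc (2 * ((3 : ℝ) * m) + 1) ^ 3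
        ≤ (3 * (2 * (m : ℝ) + 1)) ^ 3 := pow_le_pow_left₀ (by positivity) this 3
      _ = 27 * N := by rw [hN_def]; ring
  have key2 : N * N ≤ C * ((t : ℝ) ^ 4) ^ 2 * (2 * ((3 : ℝ) * m) + 1) ^ 3 := by
    have h' : N * (N * N) ≤ N * (C * ((t : ℝ) ^ 4) ^ 2 * (2 * ((3 : ℝ) * m) + 1) ^ 3) := by
      calc N * (N * N) ≤ C * ((t : ℝ) ^ 4) ^ 2 * N * (2 * ((3 : ℝ) * m) + 1) ^ 3 := low.trans key
        _ = _ := by ring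
    exact le_of_mul_le_mul_left h' hN
  have hCtt : 0 ≤ C * ((t : ℝ) ^ 4) ^ 2 := by
    by_contra hneg
    push Not at hneg
    have h1 : C * ((t : ℝ) ^ 4) ^ 2 * (2 * ((3 : ℝ) * m) + 1) ^ 3 ≤ 0 :=
      mul_nonpos_of_nonpos_of_nonneg hneg.le (by positivity)
    nlinarith [mul_pos hN hN]
  have key3 : N ≤ 27 * C * (t : ℝ) ^ 8 := by
    have h2 : N * N ≤ (27 * C * (t : ℝ) ^ 8) * N := by
      calc N * N ≤ C * ((t : ℝ) ^ 4) ^ 2 * (27 * N) :=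
            key2.trans (mul_le_mul_of_nonneg_left h27 hCtt)
        _ = (27 * C * (t : ℝ) ^ 8) * N := by ring
    exact le_of_mul_le_mul_right h2 hN
  exact arith_core_at hc htC hmL' key3

/-- **R#1 literal face** (ref-1 g3's `Step2L_smallCstar`): there is NO `c₀ > 0` such that (25a)
holds `R`-uniformly for all cutoffs `c_* ∈ (0,c₀]` — take `c_* = min c₀ 1`.
[cite: AbuGhuwaleh2026b, Thm 4.2 (25) p.10; p.2 l.20–25] -/
theorem not_Step2L_Thm42_25a_small :
    ¬ ∃ c₀ : ℝ, 0 < c₀ ∧ ∀ cstar : ℝ, 0 < cstar → cstar ≤ c₀ → ∃ C : ℝ, ∀ R : ℝ, 1 ≤ R →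
      ∀ (A : Finset Z3) (a : Z3 → ℝ), (∀ p ∈ A, lnorm p ≤ cstar * R ^ (3 / 4 : ℝ)) →
        (∑ p ∈ A, |a p|) ^ 2 ≤ C * R ^ 2 * ∑ p ∈ A, a p ^ 2 := by
  rintro ⟨c₀, hc₀, h⟩
  exact not_Step2L_Thm42_25a_at (lt_min hc₀ one_pos) (min_le_right c₀ 1)
    (h (min c₀ 1) (lt_min hc₀ one_pos) (min_le_left c₀ 1))

/-- **R#1 chain face** (ref-1 g3's `Step2_smallCstar`, RETYPE.md §2): there is NO `c₀ > 0` such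
that (24)–(25) hold `R`-uniformly for all cutoffs `c_* ∈ (0,c₀]` — take `c_* = min c₀ 1`. The
print's «c_* sufficiently small, fixed once and for all» (p.2 l.20–25) does not rescue Step 2.
[cite: AbuGhuwaleh2026b, Thm 4.2 (24)–(25) p.10; proof p.11 l.1–9; p.2 l.20–25] -/
theorem not_Step2_Thm42_2425_small :
    ¬ ∃ c₀ : ℝ, 0 < c₀ ∧ ∀ cstar : ℝ, 0 < cstar → cstar ≤ c₀ → ∃ C : ℝ, ∀ R : ℝ, 1 ≤ R →
      ∀ (A K : Finset Z3) (a v : Z3 → ℝ),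
        (∀ p ∈ A, lnorm p ≤ cstar * R ^ (3 / 4 : ℝ)) →
        (∀ k ∈ K, R ≤ lnorm k ∧ lnorm k ≤ 2 * R) → (∀ k, k ∉ K → v k = 0) →
          absSum A K a v ≤ C * R ^ 2 * (∑ p ∈ A, a p ^ 2) * (∑ k ∈ K, v k ^ 2) := by
  rintro ⟨c₀, hc₀, h⟩
  exact not_Step2_Thm42_2425_at (lt_min hc₀ one_pos) (min_le_right c₀ 1)
    (h (min c₀ 1) (lt_min hc₀ one_pos) (min_le_left c₀ 1))

/-- The kill of record is the `c_* = 1` instance of `not_Step2_Thm42_2425_at` (consistency check: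
the typed decl quantifies `∀ c_* ∈ (0,1]`, so ANY single cutoff refutes it). -/
theorem not_Step2_Thm42_2425_of_at (c : ℝ) (hc : 0 < c) (hc1 : c ≤ 1) :
    ¬ Literature.Claims.NS.AbuGhuwaleh2026b.Step2_Thm42_2425 := fun h =>
  not_Step2_Thm42_2425_at hc hc1 (h c hc hc1)

end Summit.NavierStokesRegularity.NavierStokesRegularity.Theorems.AbuGhuwaleh2026b
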